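import Literature.NumberTheory.LFunctions.Zhang2022.DetectorDictShiftDensity
import Literature.NumberTheory.LFunctions.Zhang2022.DetectorTwoPointIdentity
import Literature.NumberTheory.LFunctions.Zhang2022.RepairDetGlued
import Literature.NumberTheory.LFunctions.Zhang2022.DetectorTwoSidedGlued

/-!
# Zhang (2022), programme F-S3 (cell landau-siegel §E, row S-E-p6-3, kernel leaf [K7] Part 4): the two-sided slot
# DISCHARGED — `Det.DictShiftPSD b` for EVERY sign-admissible `b` (all geometries, overlap included), hence
# `Det.GluedFormPSD b`, and the glued §E rows read UNCONDITIONALLY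

Y. Zhang, *Discrete mean estimates and the Landau–Siegel zero*, arXiv:2211.02515v1 [Zhang2022LandauSiegel] —
an unrefereed manuscript under adjudication. **WHAT THIS IS NOT: not a claim about Theorems 1–2 of
arXiv:2211.02515, about Landau–Siegel zeros, about a repaired `Margin232`, or about Parity. The programme SEARCHES
and TYPES; no claim about Landau–Siegel zeros, Theorems 1–2 of arXiv:2211.02515 or a repaired Margin232 until a
kernel theorem says so.**

ASSEMBLY of the cell's two-sided chain for the one-form dictionary `Det.DictShift b` (ls-Bdet-typer-1; = the cell's
windowed glued main-term form (4.1)_S, ls-num-2 Id-7, ls-theory PASS):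
* K1‴ general-apex closed form + circle assembly: `Det.dictShift_nonneg_kinked_of_bridges` (`DetectorDictShiftCircle`,
  ls-barrier-p6 g3; F0DetC-vocabulary twin `Det.dictShift_nonneg_of_twoPointPieces`, `DetectorDictCircle`, ls-barrier-num g3);
* K2″ the unit bridge for every jet datum: `Det.twoPoint_pieces` (`DetectorTwoPointIdentity`, ls-barrier-num g3) — in the
  atoms `atomG`, `halfUnit`; the DICTIONARY to the tree's glue pair (`shiftGlueW = shiftN·shiftWoverB`,
  `shiftGlue0 = −u₀u₁u₂`, ls-barrier-num's GlueDict text) gives `twoPointGlue b I (−a₀) 0 (−conj a₁) = crossJet b a₀ a₁ I`;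
* K3′ Parseval on the circle (`DetectorShiftDoubledParseval`, ls-Bmulti-typer-2) and K4/K5 (lattice symbol, `c₀ > 0`) inside;
* the `H¹` lift `Det.dictShiftPSD_of_bridges` (`DetectorDictShiftDensity`, ls-barrier-p6 g3).

RESULTS: **`Det.dictShift_nonneg_of_signAdmissible`** (kinked profiles), **`Det.dictShiftPSD_of_signAdmissible :
SignAdmissible b → DictShiftPSD b`** (the slot of `Repair.familyDetGlued`; the slot `GluedFormPSD b` of `Repair.familyDetGluedSep`
is ls-barrier-p5 g4's `Det.gluedFormPSD_of_signAdmissible`, `DetectorTwoSidedGlued`, cited), and the §E rows READ UNCONDITIONALLY: `Repair.detGlued_not_closing` (every glued design with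
`H¹` legs: `¬ (DictShift_b(G)·DictShift_b(f) < ‖P^dict_b(G,f)‖²)` OUTRIGHT), `Repair.detGluedSep_not_closing`, the
slot-free family **`Repair.familyDetGluedUncond`** (designs/class of `familyDetGlued` verbatim) with `_decided`,
`rplus_detGluedUncond_decided`, and the manuscript's own glued legs `(𝔤_θ, f_θ)` under EVERY admissible detector
(`gluedLeg_not_closing`). 0 named facts; 0 sorries; standard axioms.

References: arXiv:2211.02515v1 §2 (2.13), Lemma 2.3, (2.18), (2.27), (2.32)–(2.33); §4 (4.1); Prop. 7.1 p.44 with (7.2),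
(8.11)–(8.23); §12 (12.6)–(12.8); Prop. 14.1; Lemma 15.1; §18 (18.1). [cite: Zhang2022LandauSiegel, §§2, 4, 7–8, 12, 14–15, 18]
-/

noncomputable section

open Complex Real ComplexConjugate Set MeasureTheory intervalIntegral

namespace Literature.NumberTheory.LFunctions.Zhang2022

namespace Det

open Repair

variable {b : Fin 3 → ℝ} {G G' : ℝ → ℂ}

/-! ### The dictionary between the K2″ atoms and the tree's glue pair -/

/-- `W′_j = N_j·ω_j` for `b_j ≠ 0` (`Det.shiftGlueW = W·n/b`, `Det.shiftW_eq_mul_shiftWoverB`).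
[cite: Zhang2022LandauSiegel, Lemma 15.1; proof of Prop 7.1 (7.19)–(7.21)] -/
theorem shiftGlueW_eq_shiftN_mul_shiftWoverB (j : Fin 3) (hbj : b j ≠ 0) :
    shiftGlueW b j = (shiftN b j : ℂ) * shiftWoverB b j := by
  have hbj' : (b j : ℂ) ≠ 0 := by exact_mod_cast hbj
  unfold shiftGlueW
  rw [shiftW_eq_mul_shiftWoverB]
  field_simp

/-- `Σ_j W′_j = atomG` for a triple with non-zero entries. [cite: Zhang2022LandauSiegel, Lemma 15.1] -/
theorem sum_shiftGlueW_eq_atomG (hb : ∀ j, b j ≠ 0) : (∑ j : Fin 3, shiftGlueW b j) = atomG b := by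
  unfold atomG
  exact Finset.sum_congr rfl fun j _ => shiftGlueW_eq_shiftN_mul_shiftWoverB j (hb j)

/-- `c_g = −u₀u₁u₂` (`Det.shiftGlue0 b = −exp(iπΣb/2)`, `Det.halfUnit b m = exp(iπb_m/2)`). [cite: Zhang2022LandauSiegel, Lemma 5.2 p.10] -/
theorem shiftGlue0_eq_neg_halfUnit_prod (b : Fin 3 → ℝ) :
    shiftGlue0 b = -(halfUnit b 0 * halfUnit b 1 * halfUnit b 2) := by
  unfold shiftGlue0 halfUnit
  rw [← Complex.exp_add, ← Complex.exp_add, Fin.sum_univ_three]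
  congr 2
  push_cast
  ring

/-- **The K2″ glue block at the jets of a profile IS K1‴'s cross jet form**:
`twoPointGlue b I (−a₀) 0 (−conj a₁) = crossJet b a₀ a₁ I` (`b_j ≠ 0`). [cite: Zhang2022LandauSiegel, Prop 14.1; Lemma 15.1; §18 (18.1)] -/
theorem twoPointGlue_eq_crossJet (hb : ∀ j, b j ≠ 0) (a₀ a₁ Ig : ℂ) :
    twoPointGlue b Ig (-a₀) 0 (-conj a₁) = crossJet b a₀ a₁ Ig := by
  rw [twoPointGlue, crossJet, sum_shiftGlueW_eq_atomG hb, shiftGlue0_eq_neg_halfUnit_prod]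
  linear_combination ((π : ℂ) * atomAN b * Ig * conj a₁) * Complex.I_sq

/-! ### The slot discharged -/

/-- **[K7] `DictShift_b(G) ≥ 0` for every kinked profile `G` (free apex) and every SIGN-ADMISSIBLE `b`** — the unit
bridge of K2″ (`Det.twoPoint_pieces` with jets `(p₁,q₁,p₂,q₂) = (∫G, −G(0), 0, −conj G(1))`) fed to the circle assembly
`Det.dictShift_nonneg_kinked_of_bridges`. [cite: Zhang2022LandauSiegel, §4 (4.1); Prop 7.1 p.44 with (7.2), (8.11)–(8.23); §18 (18.1)] -/
theorem dictShift_nonneg_of_signAdmissible (hb : SignAdmissible b) (hG : KinkedProfile G G') : 0 ≤ DictShift b G G' := by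
  have hinj := hb.injective
  have h01 : b 0 ≠ b 1 := fun h => absurd (hinj h) (by decide)
  have h02 : b 0 ≠ b 2 := fun h => absurd (hinj h) (by decide)
  have h12 : b 1 ≠ b 2 := fun h => absurd (hinj h) (by decide)
  have hc : (∑ j : Fin 3, shiftW b j).re ≠ 0 := (re_sum_shiftW_pos hb).ne'
  have hb0 : ∀ j, b j ≠ 0 := fun j => (hb.pos j).ne'
  refine dictShift_nonneg_kinked_of_bridges hb (fun a₀ a₁ Ig => ?_) hG
  obtain ⟨E, E', E'', hc1, hc2, hc3, hd1, hd2, h0, h0', h1, h1', hid⟩ :=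
    twoPoint_pieces b h01 h02 h12 hc Ig (-a₀) 0 (-conj a₁)
  refine ⟨E, E', E'', hc1, hc2, hc3, hd1, hd2, by simpa using h0, by simpa using h0', h1, h1', ?_⟩
  rw [← twoPointGlue_eq_crossJet hb0]
  exact hid

/-- **[K7] THE TWO-SIDED SLOT: `Det.DictShiftPSD b` for every sign-admissible `b`** — the cell's windowed glued
main-term form is PSD on ALL `H¹` profiles of `[0,1]` (glued / overlapping / one-sided alike; the `H¹` lift
`Det.dictShiftPSD_of_kinked`). The displayed slot of `Repair.familyDetGlued` is a theorem on its whole class.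
[cite: Zhang2022LandauSiegel, §4 (4.1); §2 (2.18)–(2.19); Prop 7.1 p.44 with (7.2), (8.11)–(8.23); §18 (18.1)] -/
theorem dictShiftPSD_of_signAdmissible (hb : SignAdmissible b) : DictShiftPSD b :=
  dictShiftPSD_of_kinked fun _ _ hG => dictShift_nonneg_of_signAdmissible hb hG

/- The no-overlap glued slot `Det.GluedFormPSD b` for sign-admissible `b` is ls-barrier-p5 g4's
`Det.gluedFormPSD_of_signAdmissible` (`DetectorTwoSidedGlued`, the direct two-sided route); it also follows from
`dictShiftPSD_of_signAdmissible` by `DictShiftPSD.gluedFormPSD`. We cite the landed declaration below. -/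

/-- Exact Cauchy–Schwarz in the glued currency, unconditionally, for `H¹` legs and sign-admissible `b`.
[cite: Zhang2022LandauSiegel, §2 (2.18)–(2.19), (2.32)–(2.33); §4 (4.1)] -/
theorem norm_sq_dictShiftPolar_le_of_signAdmissible (hb : SignAdmissible b) {u u' f f' : ℝ → ℂ}
    (hu : IsH1OnUnitInterval u u') (hf : IsH1OnUnitInterval f f') :
    ‖DictShiftPolar b u u' f f'‖ ^ 2 ≤ DictShift b u u' * DictShift b f f' :=
  norm_sq_dictShiftPolar_le_of_psd (dictShiftPSD_of_signAdmissible hb) hu hf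

end Det

namespace Repair

open Det

/-! ### The glued §E rows read UNCONDITIONALLY -/

namespace DetShiftDesign

/-- **The slot-free glued verdict**: `¬ (DictShift_b(G)·DictShift_b(f) < ‖P^dict_b(G,f)‖²)`.
[cite: Zhang2022LandauSiegel, §2 (2.18), Props. 2.4–2.6, (2.32)–(2.33); §4 (4.1)] -/
def VerdictGluedFree (d : DetShiftDesign) : Prop :=
  ¬ (DictShift d.b d.u d.u' * DictShift d.b d.f d.f' < ‖DictShiftPolar d.b d.u d.u' d.f d.f'‖ ^ 2)

/-- The glued verdict IS «slot → slot-free glued verdict». [cite: Zhang2022LandauSiegel, §2 (2.32)–(2.33)] -/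
theorem verdictGlued_iff (d : DetShiftDesign) : d.VerdictGlued ↔ (DictShiftPSD d.b → d.VerdictGluedFree) := Iff.rfl

/-- On the glued class the slot holds (K7). [cite: Zhang2022LandauSiegel, §4 (4.1); Prop 7.1 p.44] -/
theorem InClassGlued.slot {d : DetShiftDesign} (h : d.InClassGlued) : DictShiftPSD d.b :=
  dictShiftPSD_of_signAdmissible h.1

end DetShiftDesign

/-- **NOT REPAIRABLE BY A SIGN-ADMISSIBLE SHIFT DETECTOR ON GLUED `H¹` LEGS — UNCONDITIONAL, CLASS-WIDE.** For every
design of `familyDetGlued` (any sign-admissible `b` in the Part-III box; the `H`-leg `G` and the probe `f` ANY `H¹` profiles —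
two-sided with any overlap, one-sided, tents crossing the reflected side): `¬ (DictShift_b(G)·DictShift_b(f) < ‖P^dict_b(G,f)‖²)`.
[cite: Zhang2022LandauSiegel, §2 (2.18), Props. 2.4–2.6, (2.32)–(2.33); §4 (4.1); §18 (18.1)] -/
theorem detGlued_not_closing : ∀ d : DetShiftDesign, d.InClassGlued → d.VerdictGluedFree :=
  fun d h => not_repairable_detGlued d h h.slot

/-- Verdict AND slot, member by member (row S-E-p6-3 Family A reads «UNCONDITIONAL class-wide»).
[cite: Zhang2022LandauSiegel, §2 (2.32)–(2.33)] -/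
theorem familyDetGlued_verdict_and_slot (d : DetShiftDesign) (h : d.InClassGlued) :
    familyDetGlued.Verdict d ∧ DictShiftPSD d.b :=
  ⟨familyDetGlued_decided d h, h.slot⟩

/-- the threshold shape of the §2 final step on the glued class, unconditionally.
[cite: Zhang2022LandauSiegel, §2 (2.18), Props. 2.4–2.6 p.6, (2.32)–(2.33)] -/
theorem not_sqrt_closing_detGlued_unconditional (d : DetShiftDesign) (h : d.InClassGlued) {q cJ dd : ℝ}
    (hq : DictShift d.b d.u d.u' ≤ q) (hcJ : DictShift d.b d.f d.f' ≤ cJ)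
    (hd : dd ≤ ‖DictShiftPolar d.b d.u d.u' d.f d.f'‖) : ¬ (Real.sqrt (q * cJ) < dd) :=
  not_sqrt_closing_detGlued d h h.slot hq hcJ hd

/-- **family «sign-admissible shift detector, glued `H¹` legs, DictShift currency — SLOT-FREE verdict»** (designs and
class of `familyDetGlued` verbatim). [cite: Zhang2022LandauSiegel, §2 Lemma 2.3, (2.18)–(2.19), (2.32)–(2.33); §4 (4.1)] -/
def familyDetGluedUncond : DesignFamily where
  Design := DetShiftDesign
  InClass := DetShiftDesign.InClassGlued
  Verdict := DetShiftDesign.VerdictGluedFree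

/-- Same designs, same class as `familyDetGlued` — only the verdict changed (slot removed).
[cite: Zhang2022LandauSiegel, §2 (2.32)–(2.33)] -/
theorem familyDetGluedUncond_sameClass :
    familyDetGluedUncond.Design = familyDetGlued.Design ∧
      ∀ d : DetShiftDesign, familyDetGluedUncond.InClass d ↔ familyDetGlued.InClass d :=
  ⟨rfl, fun _ => Iff.rfl⟩

/-- **`familyDetGluedUncond` is decided.** [cite: Zhang2022LandauSiegel, §2 (2.32)–(2.33)] -/
theorem familyDetGluedUncond_decided : familyDetGluedUncond.Decided := detGlued_not_closing

/-- **`R⁺ ++ [familyDetGluedUncond]` is decided.** [cite: Zhang2022LandauSiegel, §2 (2.32)–(2.33)] -/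
theorem rplus_detGluedUncond_decided : ClassDecided (Rplus ++ [familyDetGluedUncond]) :=
  rplus_extend familyDetGluedUncond_decided

/-- **Family B unconditionally**: every no-overlap glued design satisfies its verdict's conclusion OUTRIGHT
(slot `GluedFormPSD b` = `Det.gluedFormPSD_of_signAdmissible`, ls-barrier-p5 g4). [cite: Zhang2022LandauSiegel, §2 (2.32)–(2.33); §12 (12.6)–(12.8); §18 (18.1)] -/
theorem detGluedSep_not_closing (d : DetGluedSepDesign) (h : d.InClass) :
    ¬ (FormDetGlued d.b d.g₁ d.g₁' d.g₂ d.g₂' * FormDetGlued d.b d.f₁ d.f₁' d.f₂ d.f₂' <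
        ‖DictShiftPolar d.b (gluedProfile d.g₁ d.g₂) (gluedDeriv d.g₁' d.g₂')
            (gluedProfile d.f₁ d.f₂) (gluedDeriv d.f₁' d.f₂')‖ ^ 2) :=
  not_repairable_detGluedSep d h (gluedFormPSD_of_signAdmissible h.1)

/-- Family B: verdict AND slot, member by member. [cite: Zhang2022LandauSiegel, §2 (2.32)–(2.33)] -/
theorem familyDetGluedSep_verdict_and_slot (d : DetGluedSepDesign) (h : d.InClass) :
    familyDetGluedSep.Verdict d ∧ GluedFormPSD d.b :=
  ⟨familyDetGluedSep_decided d h, gluedFormPSD_of_signAdmissible h.1⟩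

section Legs

variable {θ : Theta} {b : Fin 3 → ℝ}

/-- **The manuscript's own glued legs `(𝔤_θ, f_θ)` under EVERY admissible detector, unconditionally:**
`¬ (DictShift_b(𝔤_θ)·DictShift_b(f_θ) < ‖P^dict_b(𝔤_θ, f_θ)‖²)` for every calculus-class `θ` (overlap `[1−ν₂, ν₁]`
included); at `b = (1,2,3)` this is row 1's `¬ (C₂₃₂S·C₂₃₃T < |𝔡+𝔡′|²)` (`detGlued_std_gluedLeg_verdict_iff`).
[cite: Zhang2022LandauSiegel, §2 (2.32)–(2.33); §4 (4.1); §10 (10.1)] -/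
theorem gluedLeg_not_closing (hb : SignAdmissible b ∧ InShiftBox b) (hθ : AdmissibleThetaCalc θ) :
    (gluedLeg b θ).VerdictGluedFree :=
  detGlued_not_closing (gluedLeg b θ) (inClass_gluedLeg hb hθ)

/-- The named members at `θ₀` for the two off-print boxes `bOffLattice`, `bNearLattice` carry the CONCLUSION.
[cite: Zhang2022LandauSiegel, §2 (2.13), (2.21)–(2.28)] -/
theorem gluedLeg_theta0_not_closing :
    (gluedLeg bOffLattice theta0).VerdictGluedFree ∧ (gluedLeg bNearLattice theta0).VerdictGluedFree :=
  ⟨gluedLeg_not_closing signAdmissible_bOffLattice admissible_theta0.toCalc,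
    gluedLeg_not_closing signAdmissible_bNearLattice admissible_theta0.toCalc⟩

end Legs

end Repair

end Literature.NumberTheory.LFunctions.Zhang2022
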